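import Summits.NavierStokesRegularity.NavierStokesRegularity.Theorems.SoloSalvageWu2026PressureCompactScaling
import HarnessLib

/-!
# C177 `Wu2026` — toward `Step_construct` (B), pressure compactness (3.45): convergence of the local
# Riesz parts, and `L²` convergence on a ball from the split `P_j = L_j + H_j`

Seat `ns-in-wu-341` on sub-binder (B) of `step_construct_of_pieces` (cut owner `ns-inputs-plan` g5;
holder of `Step_construct` = `ns-in-wu-con`). Salvage conventions: theorems only, standard axioms,
no definition, no named fact; `--supports` item 0897.

Print (arXiv:2608.22471v1, p.15 l.26–28, p.16 l.3–8): «The strong convergence (3.28) gives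
‖χ(V_j ⊗ V_j − V ⊗ V)‖_{L^{q₀/2}} ≤ (‖V_j‖ + ‖V‖)‖V_j − V‖_{L^{q₀}(supp χ)} → 0. Since q₀/2 > 1,
Calderón–Zygmund boundedness therefore gives L_j → L := R_iR_k(χV_iV_k) strongly in L^{q₀/2}(R³).»
… «By Arzelà–Ascoli, followed by a diagonal argument … H_j converges … Consequently, there is a
function P such that P_j → P strongly in L^{q₀/2}_loc(R³∖{0}).» Here `q₀ = 4`.

* `tendsto_eLpNorm_localRiesz_sub` — `L_j = p̃[χV_j] → p̃[χV]` in `L²(ℝ³)` along the whole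
  sequence, from `∫_S |V_j − V|⁴ → 0` on a compact `S ⊇ tsupport χ` (the tree's `L⁴ → L²`
  continuity of `w ↦ p̃[w]`, `tendsto_eLpNorm_normalisedPressure_sub_of_tendsto_two_mul`);
* `tendsto_setLIntegral_sq_of_split` — the abstract `L²(A)` convergence on a set of finite measure:
  if `P_j − L_j = H'_j` a.e. on `A`, `L_j → L` in `L²`, and the `H'_j` are uniformly bounded and
  converge pointwise (everywhere) to `h`, then `∫_A |P_j − (L + h)|² → 0` (dominated convergence
  replaces the uniform convergence of Arzelà–Ascoli).

WHAT THIS IS NOT: not a proof of `Step_construct`; not a claim about NS regularity or blow-up; not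
a claim about any author beyond the typed locator.
-/

noncomputable section

set_option linter.dupNamespace false

open MeasureTheory Set Function Filter Topology Metric
open scoped ENNReal NNReal RealInnerProductSpace

namespace Summit.NavierStokesRegularity.NavierStokesRegularity.Theorems.Wu2026Salvage

open Literature.Claims.NS.Wu2026 Literature.Analysis.FluidPDE Literature.Analysis.FunctionSpaces

-- nested operator types in the imported pressure files
set_option maxSynthPendingDepth 3

/-! ### The local Riesz parts converge in `L²(ℝ³)` -/

/-- The `L⁴` norm of a cut-off field is controlled on the support of the cut-off:
`‖χ w‖₄⁴ ≤ ∫_S ‖w‖⁴` for `|χ| ≤ 1`, `tsupport χ ⊆ S`. [folklore] -/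
theorem lintegral_cutoff_smul_rpow_four_le {χ : E3 → ℝ} (hχ01 : ∀ y, |χ y| ≤ 1) {S : Set E3}
    (hS : MeasurableSet S) (hχS : tsupport χ ⊆ S) (w : E3 → E3) :
    ∫⁻ y, ‖χ y • w y‖ₑ ^ (4 : ℝ) ≤ ∫⁻ y in S, ‖w y‖ₑ ^ (4 : ℝ) := by
  have hle : ∀ y, ‖χ y • w y‖ₑ ^ (4 : ℝ) ≤ S.indicator (fun y => ‖w y‖ₑ ^ (4 : ℝ)) y := by
    intro y
    by_cases hy : y ∈ S
    · rw [indicator_of_mem hy]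
      refine ENNReal.rpow_le_rpow ?_ (by norm_num)
      simp only [enorm_smul]
      calc ‖χ y‖ₑ * ‖w y‖ₑ ≤ 1 * ‖w y‖ₑ := by
            refine mul_le_mul' ?_ le_rfl
            rw [← ofReal_norm, Real.norm_eq_abs, ← ENNReal.ofReal_one]
            exact ENNReal.ofReal_le_ofReal (hχ01 y)
        _ = ‖w y‖ₑ := one_mul _
    · rw [indicator_of_notMem hy]
      have hχ0 : χ y = 0 := image_eq_zero_of_notMem_tsupport fun h => hy (hχS h)
      simp [hχ0]
  calc ∫⁻ y, ‖χ y • w y‖ₑ ^ (4 : ℝ) ≤ ∫⁻ y, S.indicator (fun y => ‖w y‖ₑ ^ (4 : ℝ)) y :=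
        lintegral_mono hle
    _ = ∫⁻ y in S, ‖w y‖ₑ ^ (4 : ℝ) := lintegral_indicator hS _

/-- **`L_j → L` strongly in `L²(ℝ³)`** (p.15 l.26–28, `q₀ = 4`): for `v` continuous, a continuous
cut-off `χ` with compact support, `|χ| ≤ 1`, `tsupport χ ⊆ S` compact, and a measurable `V` with
`∫_S |V|⁴ < ∞` and `∫_S |V_j − V|⁴ → 0` (`V_j = blowDown R_j v`): `p̃[χV_j] → p̃[χV]` in `L²`.
[cite: Wu2026, p.15 l.26–28; Tsai1998, Lemma 2.1 proof (p. 34)] -/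
theorem tendsto_eLpNorm_localRiesz_sub {v : E3 → E3} (hv : Continuous v) {χ : E3 → ℝ}
    (hχ : Continuous χ) (hχc : HasCompactSupport χ) (hχ01 : ∀ y, |χ y| ≤ 1)
    {S : Set E3} (hS : IsCompact S) (hχS : tsupport χ ⊆ S) {V : E3 → E3}
    (hVm : AEStronglyMeasurable V volume) (hVS : IntegrableOn (fun y => ‖V y‖ ^ (4 : ℝ)) S volume)
    {Rj : ℕ → ℝ}
    (hconv : Tendsto (fun j => ∫ y in S, ‖blowDown (Rj j) v y - V y‖ ^ (4 : ℝ)) atTop (𝓝 0)) :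
    Tendsto (fun j => eLpNorm (fun y => normalisedPressure (fun y => χ y • blowDown (Rj j) v y) y -
      normalisedPressure (fun y => χ y • V y) y) 2 volume) atTop (𝓝 0) := by
  have h2_1 : (1 : ℝ≥0∞) < 2 := by norm_num
  have h2_t : (2 : ℝ≥0∞) < ⊤ := ENNReal.ofNat_lt_top
  have h22_0 : (2 * 2 : ℝ≥0∞) ≠ 0 := by norm_num
  have h22_t : (2 * 2 : ℝ≥0∞) ≠ ⊤ := by norm_num
  have h22_r : (2 * 2 : ℝ≥0∞).toReal = 4 := by norm_num
  have hSm : MeasurableSet S := hS.measurableSet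
  -- (3.28) on `S` in `ℝ≥0∞` form
  have hl : Tendsto (fun j => ∫⁻ y in S, ‖blowDown (Rj j) v y - V y‖ₑ ^ (4 : ℝ)) atTop (𝓝 0) :=
    tendsto_lintegral_V_sub_of_integral hv hS hVm hVS hconv
  -- memberships in `L⁴ = L^{2·2}`
  have ha : ∀ j, MemLp (fun y => χ y • blowDown (Rj j) v y) (2 * 2) volume := fun j =>
    (hχ.smul (continuous_blowDown hv _)).memLp_of_hasCompactSupport hχc.smul_right
  have ha₀ : MemLp (fun y => χ y • V y) (2 * 2) volume := by
    refine ⟨hχ.aestronglyMeasurable.smul hVm, ?_⟩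
    rw [eLpNorm_lt_top_iff_lintegral_rpow_enorm_lt_top h22_0 h22_t, h22_r]
    exact (lintegral_cutoff_smul_rpow_four_le hχ01 hSm hχS V).trans_lt
      (lintegral_enorm_rpow_lt_top_of_integrableOn (by norm_num) hVS)
  -- `χV_j → χV` in `L⁴`
  have hdiff : Tendsto (fun j => eLpNorm (fun y => χ y • blowDown (Rj j) v y - χ y • V y) (2 * 2)
      volume) atTop (𝓝 0) := by
    have hb : ∀ j, eLpNorm (fun y => χ y • blowDown (Rj j) v y - χ y • V y) (2 * 2) volume ≤
        (∫⁻ y in S, ‖blowDown (Rj j) v y - V y‖ₑ ^ (4 : ℝ)) ^ (1 / (4 : ℝ)) := fun j => by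
      rw [eLpNorm_eq_lintegral_rpow_enorm_toReal h22_0 h22_t, h22_r]
      refine ENNReal.rpow_le_rpow ?_ (by norm_num)
      simp_rw [← smul_sub]
      exact lintegral_cutoff_smul_rpow_four_le hχ01 hSm hχS (fun y => blowDown (Rj j) v y - V y)
    have h0 : Tendsto (fun j => (∫⁻ y in S, ‖blowDown (Rj j) v y - V y‖ₑ ^ (4 : ℝ)) ^ (1 / (4 : ℝ)))
        atTop (𝓝 0) := by
      have hc := (ENNReal.continuous_rpow_const (y := 1 / (4 : ℝ))).tendsto (0 : ℝ≥0∞)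
      rw [ENNReal.zero_rpow_of_pos (by norm_num)] at hc
      exact hc.comp hl
    exact tendsto_of_tendsto_of_tendsto_of_le_of_le tendsto_const_nhds h0 (fun j => zero_le) hb
  exact tendsto_eLpNorm_normalisedPressure_sub_of_tendsto_two_mul (p := (2 : ℝ≥0∞)) h2_1 h2_t ha ha₀
    hdiff

/-! ### `L²` convergence on a ball from the split -/

/-- A pointwise limit of functions bounded by `B` is bounded by `B`. [folklore] -/
theorem abs_le_of_tendsto_of_abs_le {H : ℕ → E3 → ℝ} {h : E3 → ℝ} {B : ℝ}
    (hbd : ∀ j y, |H j y| ≤ B) (hpt : ∀ y, Tendsto (fun j => H j y) atTop (𝓝 (h y))) (y : E3) :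
    |h y| ≤ B :=
  le_of_tendsto ((continuous_abs.tendsto _).comp (hpt y)) (Eventually.of_forall fun j => hbd j y)

/-- **`L²(A)` convergence from the split** (p.16 l.3–8, with dominated convergence in place of the
uniform convergence of Arzelà–Ascoli): on a measurable set `A` of finite measure, if
`P_j − L_j = H'_j` a.e. on `A`, `L_j → L` in `L²(ℝ³)`, `|H'_j| ≤ B` and `H'_j → h` pointwise, then
`∫_A ‖P_j − (L + h)‖² → 0`. [cite: Wu2026, p.16 l.3–8] -/
theorem tendsto_setLIntegral_sq_of_split {Pj Lj Hrep : ℕ → E3 → ℝ} {L h : E3 → ℝ} {A : Set E3}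
    (hA : volume A < ⊤) (hLjm : ∀ j, AEStronglyMeasurable (Lj j) volume) (hLm : AEStronglyMeasurable L volume)
    (hHm : ∀ j, AEStronglyMeasurable (Hrep j) volume)
    (hsplit : ∀ j, (fun y => Pj j y - Lj j y) =ᵐ[volume.restrict A] Hrep j)
    (hL : Tendsto (fun j => eLpNorm (fun y => Lj j y - L y) 2 volume) atTop (𝓝 0))
    {B : ℝ} (hbd : ∀ j y, |Hrep j y| ≤ B) (hpt : ∀ y, Tendsto (fun j => Hrep j y) atTop (𝓝 (h y))) :
    Tendsto (fun j => ∫⁻ y in A, ‖Pj j y - (L y + h y)‖ₑ ^ (2 : ℝ)) atTop (𝓝 0) := by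
  have hhm : AEStronglyMeasurable h volume :=
    aestronglyMeasurable_of_tendsto_ae atTop hHm (Eventually.of_forall hpt)
  have hhB : ∀ y, |h y| ≤ B := abs_le_of_tendsto_of_abs_le hbd hpt
  -- the `L`-part: `∫ ‖L_j − L‖ₑ² → 0`
  have hL2 : Tendsto (fun j => ∫⁻ y, ‖Lj j y - L y‖ₑ ^ (2 : ℝ)) atTop (𝓝 0) := by
    have e : ∀ j, ∫⁻ y, ‖Lj j y - L y‖ₑ ^ (2 : ℝ) =
        eLpNorm (fun y => Lj j y - L y) 2 volume ^ (2 : ℝ) := fun j => by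
      have := eLpNorm_rpow_toReal_eq_lintegral (μ := volume) (fun y => Lj j y - L y)
        (p := (2 : ℝ≥0∞)) (by norm_num) ENNReal.ofNat_ne_top
      rw [ENNReal.toReal_ofNat] at this
      exact this.symm
    simp_rw [e]
    have hc := (ENNReal.continuous_rpow_const (y := (2 : ℝ))).tendsto (0 : ℝ≥0∞)
    rw [ENNReal.zero_rpow_of_pos (by norm_num)] at hc
    exact hc.comp hL
  -- the `H`-part on `A`: dominated convergence
  have hH2 : Tendsto (fun j => ∫⁻ y in A, ‖Hrep j y - h y‖ₑ ^ (2 : ℝ)) atTop (𝓝 0) := by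
    have hbound : ∀ j, (fun y => ‖Hrep j y - h y‖ₑ ^ (2 : ℝ)) ≤ᵐ[volume.restrict A]
        fun _ => ENNReal.ofReal ((2 * B) ^ (2 : ℝ)) := fun j => Eventually.of_forall fun y => by
      show ‖Hrep j y - h y‖ₑ ^ (2 : ℝ) ≤ ENNReal.ofReal ((2 * B) ^ (2 : ℝ))
      rw [← ofReal_norm_rpow _ (by norm_num)]
      refine ENNReal.ofReal_le_ofReal (Real.rpow_le_rpow (norm_nonneg _) ?_ (by norm_num))
      rw [Real.norm_eq_abs]
      calc |Hrep j y - h y| ≤ |Hrep j y| + |h y| := abs_sub _ _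
        _ ≤ B + B := add_le_add (hbd j y) (hhB y)
        _ = 2 * B := by ring
    have hfin : ∫⁻ _ in A, ENNReal.ofReal ((2 * B) ^ (2 : ℝ)) ≠ ⊤ := by
      rw [setLIntegral_const]
      exact ENNReal.mul_ne_top ENNReal.ofReal_ne_top hA.ne
    have hlim : ∀ᵐ y ∂(volume.restrict A),
        Tendsto (fun j => ‖Hrep j y - h y‖ₑ ^ (2 : ℝ)) atTop (𝓝 0) := by
      refine Eventually.of_forall fun y => ?_
      have h1 : Tendsto (fun j => Hrep j y - h y) atTop (𝓝 0) := by
        simpa using (hpt y).sub (tendsto_const_nhds (x := h y))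
      have h2 : Tendsto (fun j => ‖Hrep j y - h y‖ₑ) atTop (𝓝 0) := by
        simpa using h1.enorm
      have hc := (ENNReal.continuous_rpow_const (y := (2 : ℝ))).tendsto (0 : ℝ≥0∞)
      rw [ENNReal.zero_rpow_of_pos (by norm_num)] at hc
      exact hc.comp h2
    have h := tendsto_lintegral_of_dominated_convergence' (μ := volume.restrict A)
      (fun _ => ENNReal.ofReal ((2 * B) ^ (2 : ℝ)))
      (fun j => (((hHm j).sub hhm).enorm.pow_const _).restrict) hbound hfin hlim
    simpa using h
  -- combine: `‖P_j − (L + h)‖ₑ² ≤ 2(‖L_j − L‖ₑ² + ‖H'_j − h‖ₑ²)` a.e. on `A`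
  have hsum : Tendsto (fun j => 2 * ((∫⁻ y, ‖Lj j y - L y‖ₑ ^ (2 : ℝ)) +
      ∫⁻ y in A, ‖Hrep j y - h y‖ₑ ^ (2 : ℝ))) atTop (𝓝 0) := by
    simpa using ENNReal.Tendsto.const_mul (hL2.add hH2) (Or.inr ENNReal.ofNat_ne_top)
  refine tendsto_of_tendsto_of_tendsto_of_le_of_le tendsto_const_nhds hsum (fun j => zero_le)
    fun j => ?_
  have hae : ∀ᵐ y ∂(volume.restrict A), ‖Pj j y - (L y + h y)‖ₑ ^ (2 : ℝ) ≤
      2 * (‖Lj j y - L y‖ₑ ^ (2 : ℝ) + ‖Hrep j y - h y‖ₑ ^ (2 : ℝ)) := by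
    filter_upwards [hsplit j] with y hy
    have e : Pj j y - (L y + h y) = (Lj j y - L y) + (Hrep j y - h y) := by
      rw [← hy]; ring
    rw [e]
    calc ‖(Lj j y - L y) + (Hrep j y - h y)‖ₑ ^ (2 : ℝ)
        ≤ (‖Lj j y - L y‖ₑ + ‖Hrep j y - h y‖ₑ) ^ (2 : ℝ) :=
          ENNReal.rpow_le_rpow (enorm_add_le _ _) (by norm_num)
      _ ≤ (2 : ℝ≥0∞) ^ ((2 : ℝ) - 1) * (‖Lj j y - L y‖ₑ ^ (2 : ℝ) + ‖Hrep j y - h y‖ₑ ^ (2 : ℝ)) :=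
          ENNReal.rpow_add_le_mul_rpow_add_rpow _ _ (by norm_num)
      _ = 2 * (‖Lj j y - L y‖ₑ ^ (2 : ℝ) + ‖Hrep j y - h y‖ₑ ^ (2 : ℝ)) := by norm_num
  calc ∫⁻ y in A, ‖Pj j y - (L y + h y)‖ₑ ^ (2 : ℝ)
      ≤ ∫⁻ y in A, 2 * (‖Lj j y - L y‖ₑ ^ (2 : ℝ) + ‖Hrep j y - h y‖ₑ ^ (2 : ℝ)) :=
        lintegral_mono_ae hae
    _ = 2 * ((∫⁻ y in A, ‖Lj j y - L y‖ₑ ^ (2 : ℝ)) + ∫⁻ y in A, ‖Hrep j y - h y‖ₑ ^ (2 : ℝ)) := by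
        have hmeas : AEMeasurable (fun y => ‖Lj j y - L y‖ₑ ^ (2 : ℝ)) (volume.restrict A) :=
          (((hLjm j).sub hLm).enorm.pow_const _).restrict
        rw [lintegral_const_mul' _ _ ENNReal.ofNat_ne_top, lintegral_add_left' hmeas]
    _ ≤ 2 * ((∫⁻ y, ‖Lj j y - L y‖ₑ ^ (2 : ℝ)) + ∫⁻ y in A, ‖Hrep j y - h y‖ₑ ^ (2 : ℝ)) := by
        gcongr
        exact Measure.restrict_le_self

end Summit.NavierStokesRegularity.NavierStokesRegularity.Theorems.Wu2026Salvage

end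

-- WHAT THIS IS NOT: not a claim about NS regularity or blow-up; not a claim about any author beyond the typed locator.
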